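import Summits.QuantumFields.YangMills.Theorems.UnitScaleTiltProp7SymFrameLinearResponseOfRegPrT3
import Summits.QuantumFields.YangMills.Theorems.UnitScaleTiltProp7Chart48SymUntwisted
import Summits.QuantumFields.YangMills.Theorems.UnitScaleTiltProp7PertVarCurrencyExchange
import Mathlib.Analysis.SpecialFunctions.Exponential
import HarnessLib

/-!
# `UnitScaleTiltProp7FrameRem2RowZeroT3` — THE LEVEL-0 INSTANCE OF THE «(n3)₂-sym» ROW DISPLAYED BY ✓`Prop7FrameRem2OfRegPrT3.sum_norm_frameTwS_sub_one_sub_fderiv_le_of_regPr` (`hR` at `l = 0`),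
# BY KERNEL: `‖pertVar W (e^{iD}W) b − D[Ū⁽⁰⁾(e^{·}·W♭)(b)](0)(iD)·(W b)⋆‖ = ‖e^{iD_b} − 1 − iD_b‖ ≤ ‖D_b‖²∕2`
(route `UnitScaleTilt`, crux K1 «MinimiserStabilityRegPr» stmt-QuantumFields-19200; R0-RECURSION lane, ★★OWNER RULINGS №19 (3)∕№20; def-free, count-neutral).
Cell `ym3-torus` (HUMAN RULING D-0037, YM ladder rung R3 — YM₃ on T³ is a rung, not d = 4, not infinite volume, not a mass gap, not Clay), width seat `ym3-torus-px13` (gen 6).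

PURPOSE.  (i) It certifies the ORIENTATION of the displayed linear part `ℓY_l(b) = D[Ū⁽ˡ⁾(e^{·}·W♭)(b)](0)(iD) · (Ūˡ[W](b))⋆` against the tree's `pertVar U₀ U b = U_b·U₀,b⋆ − 1` (lit `pertVar_eq`): at `l = 0`
the linear part IS `iD_b` (`fderiv_exp_apply_mul`, `Ū⁽⁰⁾ = id`, `W_bW_b⋆ = 1`), and the row is the sharp unitary second-order bound ✓`Prop7PertVarCurrencyExchange.norm_pertVar_sub_lin_le`;
(ii) it is the base case `rem_0` of the supplier's level recursion `rem_{l+1} = Lin_l(rem_l) + Q_l(Y_l)` (see the bus note of record), with `Σ_b R 0 b = ½Σ_b‖D_b‖²`.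
WHAT IS PROVED (sorry-free): `hasFDerivAt_exp_apply_mul`, `fderiv_exp_apply_mul` (the derivative of `t ↦ e^{t_b}·c` at `0` is `A ↦ A_b·c`), `coe_emb15_expHermField_apply` (`(e^{iD}W)_b = e^{iD_b}·W_b` in `M₂`),
`fderiv_emlIterU_zero_mul_star_eq` (the level-0 linear part is `iD_b`), ★ `norm_pertVar_sub_fderiv_le_level_zero` (the title), `sum_norm_pertVar_sub_fderiv_le_level_zero` (summed).
HONEST FRAMING.  The level-0 row only (S); levels `1 ≤ l ≤ K − n` of «(n3)₂-sym» are OPEN (L∕XL, (n3)'s straight∕contour mechanism at second order); nothing of (β)∕the crux is proved; rung R3, not Clay;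
YM gap NOT proved.  `--supports stmt-QuantumFields-19200 --as helper`.
References: T. Bałaban, CMP 102 (1985) 277–309 [Balaban1985Variational] ((15) p.280, (19) p.281, (44) p.285); CMP 98 (1985) 17–51 [Balaban1985Averaging] ((24) p.21); CMP 109 (1987) 249–301
[Balaban1987RG1] ((0.4) p.253).
-/

set_option autoImplicit false

noncomputable section

open scoped BigOperators Matrix.Norms.L2Operator

namespace Summit.QuantumFields.YangMills.Theorems.Prop7FrameRem2RowZeroT3

open Finset NormedSpace
open Literature.MathematicalPhysics.QuantumFieldTheory.Balaban1983to89
open Literature.MathematicalPhysics.QuantumFieldTheory.Balaban1983to89.T3ContinuumYM3Torus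
open T4Continuum BlockAveraging AveragingRT ExpMeanLog BlockAveragingEMLLinearisedBackground
open T3SectALandauChart (emb15 bgUnits)
open B10Eq27TorusAxialLog (unitsField toUField)
open B7Prop1Explicit (expUnit val_expUnit)
open Summit.QuantumFields.YangMills.Theorems.Prop8Chart (emlIterU emlIterU_zero coe_unitsField_toUField)
open Summit.QuantumFields.YangMills.Theorems.Prop7TPrint (expHermField)
open Summit.QuantumFields.YangMills.Theorems.Prop7SymFrameBound (bgUnits_eq_unitsField)
open Summit.QuantumFields.YangMills.Theorems.Prop7Chart48SymUntwisted (unitsField_toUField_emb15_expHermField)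
open Summit.QuantumFields.YangMills.Theorems.Prop7HolRatioPerStep (coe_mul_star_self)
open Summit.QuantumFields.YangMills.Theorems.Prop7PertVarCurrencyExchange (norm_pertVar_sub_lin_le)

/-! ## §1 The derivative of `t ↦ e^{t_b}·c` at `t = 0` -/

section Calculus

variable {ι : Type*} [Fintype ι]

/-- `t ↦ exp(t_b)·c` has derivative `A ↦ A_b·c` at `t = 0` (chain rule through the evaluation map, ✓`hasFDerivAt_exp_zero`). [folklore] -/
theorem hasFDerivAt_exp_apply_mul (b : ι) (c : Matrix (Fin 2) (Fin 2) ℂ) :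
    HasFDerivAt (fun t : ι → Matrix (Fin 2) (Fin 2) ℂ => exp (t b) * c)
      (((1 : Matrix (Fin 2) (Fin 2) ℂ →L[ℂ] Matrix (Fin 2) (Fin 2) ℂ).comp (ContinuousLinearMap.proj b)).smulRight c) 0 := by
  have h1 : HasFDerivAt (fun t : ι → Matrix (Fin 2) (Fin 2) ℂ => t b) (ContinuousLinearMap.proj b) 0 :=
    (ContinuousLinearMap.proj (R := ℂ) (φ := fun _ : ι => Matrix (Fin 2) (Fin 2) ℂ) b).hasFDerivAt
  have h2 : HasFDerivAt (exp : Matrix (Fin 2) (Fin 2) ℂ → Matrix (Fin 2) (Fin 2) ℂ) (1 : Matrix (Fin 2) (Fin 2) ℂ →L[ℂ] Matrix (Fin 2) (Fin 2) ℂ)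
      ((fun t : ι → Matrix (Fin 2) (Fin 2) ℂ => t b) 0) := hasFDerivAt_exp_zero
  exact (h2.comp 0 h1).mul_const' c

/-- `fderiv ℂ (t ↦ exp(t_b)·c) 0 A = A_b·c`. [folklore] -/
theorem fderiv_exp_apply_mul (b : ι) (c : Matrix (Fin 2) (Fin 2) ℂ) (A : ι → Matrix (Fin 2) (Fin 2) ℂ) :
    fderiv ℂ (fun t : ι → Matrix (Fin 2) (Fin 2) ℂ => exp (t b) * c) 0 A = A b * c := by
  rw [(hasFDerivAt_exp_apply_mul b c).fderiv]
  simp [smul_eq_mul]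

end Calculus

/-! ## §2 The level-0 row -/

section T3

variable (F : T3Family) {K : ℕ}

/-- `(e^{iD}W)_b = e^{iD_b}·W_b` read in `M₂` (✓`unitsField_toUField_emb15_expHermField`, bondwise). [cite: Balaban1985Variational, (15) p.280, (19) p.281] -/
theorem coe_emb15_expHermField_apply (W : GaugeField (F.P K) 0 (Matrix.specialUnitaryGroup (Fin 2) ℂ))
    (D : PBond (F.P K) 0 → Matrix (Fin 2) (Fin 2) ℂ) (hD : ∀ b : PBond (F.P K) 0, (D b).IsHermitian ∧ Matrix.trace (D b) = 0) (b : PBond (F.P K) 0) :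
    ((emb15 W (expHermField D) b : Matrix.specialUnitaryGroup (Fin 2) ℂ) : Matrix (Fin 2) (Fin 2) ℂ)
      = exp (Complex.I • D b) * ((W b : Matrix.specialUnitaryGroup (Fin 2) ℂ) : Matrix (Fin 2) (Fin 2) ℂ) := by
  have h := congrArg (fun f : PBond (F.P K) 0 → (Matrix (Fin 2) (Fin 2) ℂ)ˣ => ((f b : (Matrix (Fin 2) (Fin 2) ℂ)ˣ) : Matrix (Fin 2) (Fin 2) ℂ))
    (unitsField_toUField_emb15_expHermField (F := F) (K := K) W D hD)
  simp only [Units.val_mul, val_expUnit] at h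
  rw [coe_unitsField_toUField, bgUnits_eq_unitsField, coe_unitsField_toUField] at h
  exact h

/-- **THE LEVEL-0 LINEAR PART IS `iD_b`**: `D[Ū⁽⁰⁾(e^{·}·W♭)(b)](0)(iD) · (Ū⁰[W](b))⋆ = iD_b` (`Ū⁽⁰⁾ = id`, `W_bW_b⋆ = 1`). [cite: Balaban1987RG1, (0.4) p.253; Balaban1985Variational, (15) p.280] -/
theorem fderiv_emlIterU_zero_mul_star_eq (W : GaugeField (F.P K) 0 (Matrix.specialUnitaryGroup (Fin 2) ℂ))
    (D : PBond (F.P K) 0 → Matrix (Fin 2) (Fin 2) ℂ) (b : PBond (F.P K) 0) :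
    fderiv ℂ (fun t : PBond (F.P K) 0 → Matrix (Fin 2) (Fin 2) ℂ =>
        ((emlIterU 0 (fun b' => expUnit (t b') * bgUnits F K W b') b : (Matrix (Fin 2) (Fin 2) ℂ)ˣ) : Matrix (Fin 2) (Fin 2) ℂ)) 0 (fun b' => Complex.I • D b')
      * star ((Averaging.iter (fun i => blockAvg (P := (F.P K)) (j := i) (expMeanLogSU (n := Fin 2))) 0 W b : Matrix.specialUnitaryGroup (Fin 2) ℂ) : Matrix (Fin 2) (Fin 2) ℂ)
      = Complex.I • D b := by
  have hfun : (fun t : PBond (F.P K) 0 → Matrix (Fin 2) (Fin 2) ℂ =>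
        ((emlIterU 0 (fun b' => expUnit (t b') * bgUnits F K W b') b : (Matrix (Fin 2) (Fin 2) ℂ)ˣ) : Matrix (Fin 2) (Fin 2) ℂ))
      = fun t => exp (t b) * ((W b : Matrix.specialUnitaryGroup (Fin 2) ℂ) : Matrix (Fin 2) (Fin 2) ℂ) := by
    funext t
    simp only [emlIterU_zero, Units.val_mul, val_expUnit]
    rw [bgUnits_eq_unitsField, coe_unitsField_toUField]
  rw [hfun, fderiv_exp_apply_mul]
  show Complex.I • D b * ((W b : Matrix.specialUnitaryGroup (Fin 2) ℂ) : Matrix (Fin 2) (Fin 2) ℂ) * star ((W b : Matrix.specialUnitaryGroup (Fin 2) ℂ) : Matrix (Fin 2) (Fin 2) ℂ) = _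
  rw [mul_assoc, coe_mul_star_self, mul_one]

/-- ★ **THE «(n3)₂-sym» ROW AT LEVEL 0** (`hR` of ✓`sum_norm_frameTwS_sub_one_sub_fderiv_le_of_regPr` at `l = 0`, with `R 0 b := ‖D b‖²∕2`):
`‖pertVar (Ū⁰ W) (Ū⁰ (e^{iD}W)) b − D[Ū⁽⁰⁾(e^{·}·W♭)(b)](0)(iD)·(Ū⁰[W] b)⋆‖ ≤ ‖D b‖²∕2`. [cite: Balaban1985Variational, (15) p.280, (44) p.285; Balaban1985RegularSpaces, p.84] -/
theorem norm_pertVar_sub_fderiv_le_level_zero (W : GaugeField (F.P K) 0 (Matrix.specialUnitaryGroup (Fin 2) ℂ))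
    (D : PBond (F.P K) 0 → Matrix (Fin 2) (Fin 2) ℂ) (hD : ∀ b : PBond (F.P K) 0, (D b).IsHermitian ∧ Matrix.trace (D b) = 0) (b : PBond (F.P K) 0) :
    ‖pertVar (Averaging.iter (fun i => blockAvg (P := (F.P K)) (j := i) (expMeanLogSU (n := Fin 2))) 0 W)
          (Averaging.iter (fun i => blockAvg (P := (F.P K)) (j := i) (expMeanLogSU (n := Fin 2))) 0 (emb15 W (expHermField D))) b
        - fderiv ℂ (fun t : PBond (F.P K) 0 → Matrix (Fin 2) (Fin 2) ℂ =>
            ((emlIterU 0 (fun b' => expUnit (t b') * bgUnits F K W b') b : (Matrix (Fin 2) (Fin 2) ℂ)ˣ) : Matrix (Fin 2) (Fin 2) ℂ)) 0 (fun b' => Complex.I • D b')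
          * star ((Averaging.iter (fun i => blockAvg (P := (F.P K)) (j := i) (expMeanLogSU (n := Fin 2))) 0 W b : Matrix.specialUnitaryGroup (Fin 2) ℂ) : Matrix (Fin 2) (Fin 2) ℂ)‖
      ≤ ‖D b‖ ^ 2 / 2 := by
  rw [fderiv_emlIterU_zero_mul_star_eq]
  exact norm_pertVar_sub_lin_le W (emb15 W (expHermField D)) D (fun b' => (hD b').1) (coe_emb15_expHermField_apply F W D hD) b

/-- the level-0 row summed: `Σ_b R 0 b = ½·Σ_b‖D b‖²` bounds the level-0 «(n3)₂-sym» mass. [cite: Balaban1985Variational, (15) p.280, (44) p.285] -/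
theorem sum_norm_pertVar_sub_fderiv_le_level_zero (W : GaugeField (F.P K) 0 (Matrix.specialUnitaryGroup (Fin 2) ℂ))
    (D : PBond (F.P K) 0 → Matrix (Fin 2) (Fin 2) ℂ) (hD : ∀ b : PBond (F.P K) 0, (D b).IsHermitian ∧ Matrix.trace (D b) = 0) :
    ∑ b : PBond (F.P K) 0, ‖pertVar (Averaging.iter (fun i => blockAvg (P := (F.P K)) (j := i) (expMeanLogSU (n := Fin 2))) 0 W)
          (Averaging.iter (fun i => blockAvg (P := (F.P K)) (j := i) (expMeanLogSU (n := Fin 2))) 0 (emb15 W (expHermField D))) b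
        - fderiv ℂ (fun t : PBond (F.P K) 0 → Matrix (Fin 2) (Fin 2) ℂ =>
            ((emlIterU 0 (fun b' => expUnit (t b') * bgUnits F K W b') b : (Matrix (Fin 2) (Fin 2) ℂ)ˣ) : Matrix (Fin 2) (Fin 2) ℂ)) 0 (fun b' => Complex.I • D b')
          * star ((Averaging.iter (fun i => blockAvg (P := (F.P K)) (j := i) (expMeanLogSU (n := Fin 2))) 0 W b : Matrix.specialUnitaryGroup (Fin 2) ℂ) : Matrix (Fin 2) (Fin 2) ℂ)‖
      ≤ (∑ b : PBond (F.P K) 0, ‖D b‖ ^ 2) / 2 := by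
  rw [Finset.sum_div]
  exact Finset.sum_le_sum fun b _ => norm_pertVar_sub_fderiv_le_level_zero F W D hD b

end T3

end Summit.QuantumFields.YangMills.Theorems.Prop7FrameRem2RowZeroT3

end
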